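import Summits.ResolutionOfSingularities.ResolutionOfSingularities.Theorems.PurelyInseparableDim4ParamLift
import HarnessLib

/-!
# [OURS · res-dim4-pi · F4-C-loc] PARAMETRIC LIFT KIT, part 2: the Taylor coefficient of `x^γ` at a point `b` as a
  LIST SUM over the five-letter terms, and the three `decide`-able certificate checks built on it

Cell `res-dim4-pi` (D-0157 DOOR 2, wave 2), seat `res-dim4-p-6` g3; sequel of `…ParamLift` (`spec f β`, five-letter
term lists).  For a point `b` vanishing off the coordinates `U`:

* §4 `pterm` / **`coeff_translate_spec_evalT`**: `coeff_{x^γ} (translate b (spec f β (evalT G))) = Σ_t f(c_t) β^{a_t}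
  ∏ᵢ C(eᵢ,γᵢ) bᵢ^{eᵢ−γᵢ}`; the source filter `isSrcB` / `srcTerms` (`γ ≤ e|ₓ`, equal off `U`) and
  `sum_pterm_filter` (non-sources contribute `0`);
* the checks and their meaning over EVERY field `K ⊇ f(k)` and every `β ≠ 0`:
  **`pwitB` ⇒ `coeff_ne_zero_of_pwitB`** (ONE source, x-part `γ`: coefficient `f(c)·β^a ≠ 0` — no equimultiple
  point with these vanishing coordinates), **`pforceB` ⇒ `coord_eq_zero_of_pforceB`** (ONE source off `γ` by one
  letter `i`: an equimultiple point has `bᵢ = 0`), **`prootB` ⇒ `coord_cases_of_prootB`** (TWO t-free sources off by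
  consecutive powers of `xᵢ`: `bᵢ ∈ {0, f ρ}`, `ρ ∈ k` — B's extra reply is RATIONAL).

Every non-vanishing claim is about a SINGLE term `c·t^a` (`c ≠ 0` in `k`, `β ≠ 0`): no algebraic relation among
B's letters is used (sound for every `β ≠ 0`, lossy by design).  [OURS · counted 0 · instrument; AI kernel work,
weaker than expert review.]  NOTHING here is a statement about resolution of singularities; resolution in dimension
`≥ 4` / characteristic `p > 0` is NOT proved by anything in this file.  bears_on: LADDER-RESOLUTION:D157-DOOR2
(res-dim4-pi · F4-C-loc all fields · parametric rows).  Host item (DR-157-C): `stmt-ResolutionOfSingularities-16155`,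
helper.
-/

set_option linter.dupNamespace false -- mandated namespace of this single-conjunct summit

noncomputable section

open MvPolynomial Finset
open scoped BigOperators

namespace Summit.ResolutionOfSingularities.ResolutionOfSingularities.Theorems.PIDim4

namespace ParamLift

open Literature.AlgebraicGeometry.Resolution
open Literature.AlgebraicGeometry.Resolution.Hauser2010
open Literature.AlgebraicGeometry.Resolution.CentreBlowup
open StepKit

variable {k K : Type} [Field k] [Field K] [DecidableEq k] [DecidableEq K] (f : k →+* K) (β : K)

/-! ## §4 The Taylor coefficient as a list sum, and its three certificate uses -/

/-- the Taylor term of one five-letter term at the point `b`, exponent `γ`. OURS. [folklore] -/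
def pterm (γ : Fin 4 → ℕ) (b : Fin 4 → K) (t : (Fin 5 → ℕ) × k) : K :=
  f t.2 * β ^ t.1 (Fin.last 4) * ∏ i : Fin 4, (((t.1 i.castSucc).choose (γ i) : K) * b i ^ (t.1 i.castSucc - γ i))

omit [DecidableEq k] [DecidableEq K] in
/-- **the coefficient of `x^γ` in the translate of a specialised list is the list sum of the Taylor terms.**
OURS. [folklore] -/
theorem coeff_translate_spec_evalT (γ : Fin 4 → ℕ) (b : Fin 4 → K) (L : Terms 5 k) :
    coeff (expo γ) (PointBlowup.translate b (spec f β (evalT L))) = (L.map (pterm f β γ b)).sum := by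
  induction L with
  | nil => simp [PointBlowup.translate]
  | cons t L ih =>
    rw [evalT_cons, map_add, List.map_cons, List.sum_cons, ← ih]
    unfold PointBlowup.translate
    rw [map_add, coeff_add]
    congr 1
    rw [spec_monomial, map_mul, aeval_C, algebraMap_eq, coeff_C_mul]
    show _ * coeff (expo γ) (PointBlowup.translate b (monomial (expo (Fin.init t.1)) 1)) = _
    rw [WeightedBlowup.coeff_translate_monomial, one_mul]
    rfl

/-- the x-part of a five-letter exponent is a SOURCE of `γ` under translations of the coordinates `U`
(`γ ≤ e|ₓ`, equal off `U`). OURS. [folklore] -/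
def isSrcB (U : Finset (Fin 4)) (γ : Fin 4 → ℕ) (e : Fin 5 → ℕ) : Bool :=
  decide (∀ i : Fin 4, γ i ≤ e i.castSucc) && decide (∀ m : Fin 4, m ∉ U → γ m = e m.castSucc)

omit [DecidableEq k] [DecidableEq K] in
/-- a non-source contributes nothing at a point vanishing off `U`. OURS. [folklore] -/
theorem pterm_eq_zero_of_not_isSrc {U : Finset (Fin 4)} {γ : Fin 4 → ℕ} {b : Fin 4 → K}
    (hb : ∀ m : Fin 4, m ∉ U → b m = 0) {t : (Fin 5 → ℕ) × k} (h : isSrcB U γ t.1 = false) :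
    pterm f β γ b t = 0 := by
  simp only [isSrcB, Bool.and_eq_false_iff, decide_eq_false_iff_not, not_forall, exists_prop] at h
  unfold pterm
  rcases h with ⟨i, hi⟩ | ⟨m, hm, hne⟩
  · rw [Finset.prod_eq_zero (Finset.mem_univ i) (by rw [Nat.choose_eq_zero_of_lt (by omega), Nat.cast_zero,
      zero_mul]), mul_zero]
  · by_cases hlt : t.1 m.castSucc < γ m
    · rw [Finset.prod_eq_zero (Finset.mem_univ m) (by rw [Nat.choose_eq_zero_of_lt hlt, Nat.cast_zero, zero_mul]),
        mul_zero]
    · rw [Finset.prod_eq_zero (Finset.mem_univ m) (by rw [hb m hm, zero_pow (by omega), mul_zero]), mul_zero]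

omit [DecidableEq k] [DecidableEq K] in
/-- **only the sources count.** OURS. [folklore] -/
theorem sum_pterm_filter {U : Finset (Fin 4)} (γ : Fin 4 → ℕ) {b : Fin 4 → K}
    (hb : ∀ m : Fin 4, m ∉ U → b m = 0) (L : Terms 5 k) :
    (L.map (pterm f β γ b)).sum = ((L.filter fun t => isSrcB U γ t.1).map (pterm f β γ b)).sum := by
  induction L with
  | nil => rfl
  | cons t L ih =>
    rw [List.map_cons, List.sum_cons, List.filter_cons, ih]
    cases h : isSrcB U γ t.1
    · rw [pterm_eq_zero_of_not_isSrc f β hb h, zero_add]; simp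
    · simp

/-- the sources of `γ` among the terms of `G`. OURS. [folklore] -/
def srcTerms (U : Finset (Fin 4)) (γ : Fin 4 → ℕ) (G : Terms 5 k) : Terms 5 k :=
  G.filter fun t => isSrcB U γ t.1

/-- **witness check**: `γ ≠ 0`, `|γ| < q`, and the sources of `γ` are ONE term with x-part exactly `γ` and non-zero
coefficient (so the coefficient of `x^γ` is `f(c)·β^a`). OURS. [folklore] -/
def pwitB (q : ℕ) (U : Finset (Fin 4)) (G : Terms 5 k) (γ : Fin 4 → ℕ) : Bool :=
  !decide (γ = 0) && decide (∑ i, γ i < q) &&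
    match srcTerms U γ G with
    | [t] => decide (Fin.init t.1 = γ) && !decide (t.2 = 0)
    | _ => false

omit [DecidableEq K] in
/-- **a witnessed exponent has non-zero coefficient at every point vanishing off `U`, for every `β ≠ 0`.**
OURS. [folklore] -/
theorem coeff_ne_zero_of_pwitB {q : ℕ} {U : Finset (Fin 4)} {G : Terms 5 k} {γ : Fin 4 → ℕ} (hβ : β ≠ 0)
    (h : pwitB q U G γ = true) {b : Fin 4 → K} (hb : ∀ m : Fin 4, m ∉ U → b m = 0) :
    coeff (expo γ) (PointBlowup.translate b (spec f β (evalT G))) ≠ 0 := by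
  unfold pwitB at h
  simp only [Bool.and_eq_true] at h
  obtain ⟨-, hm⟩ := h
  rw [coeff_translate_spec_evalT, sum_pterm_filter f β γ hb]
  unfold srcTerms at hm
  split at hm
  · rename_i t heq
    rw [heq]
    simp only [Bool.and_eq_true, decide_eq_true_eq, Bool.not_eq_true', decide_eq_false_iff_not] at hm
    obtain ⟨hinit, hc⟩ := hm
    simp only [List.map_cons, List.map_nil, List.sum_cons, List.sum_nil, add_zero]
    unfold pterm
    have hprod : (∏ i : Fin 4, (((t.1 i.castSucc).choose (γ i) : K) * b i ^ (t.1 i.castSucc - γ i))) = 1 :=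
      Finset.prod_eq_one fun i _ => by
        have : t.1 i.castSucc = γ i := by rw [← hinit]; rfl
        rw [this, Nat.choose_self, Nat.sub_self, pow_zero, Nat.cast_one, mul_one]
    rw [hprod, mul_one]
    exact mul_ne_zero ((map_ne_zero_iff f f.injective).mpr hc) (pow_ne_zero _ hβ)
  · exact absurd hm Bool.false_ne_true

/-- **forcing check** for the letter `i ∈ U`: the sources of `γ` are ONE term, differing from `γ` exactly at `i`,
with non-zero binomial and coefficient (so the coefficient of `x^γ` is `f(c)β^a·C·bᵢ^d`, `d ≥ 1`). OURS. [folklore] -/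
def pforceB (q : ℕ) (U : Finset (Fin 4)) (G : Terms 5 k) (γ : Fin 4 → ℕ) (i : Fin 4) : Bool :=
  !decide (γ = 0) && decide (∑ i, γ i < q) && decide (i ∈ U) &&
    match srcTerms U γ G with
    | [t] => decide (∀ m : Fin 4, m ≠ i → t.1 m.castSucc = γ m) && decide (γ i < t.1 i.castSucc) &&
        !decide ((((t.1 i.castSucc).choose (γ i) : ℕ) : k) = 0) && !decide (t.2 = 0)
    | _ => false

omit [DecidableEq K] in
/-- **a forcing check kills the letter**: if the coefficient of `x^γ` vanishes at `b` then `bᵢ = 0` (`β ≠ 0`).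
OURS. [folklore] -/
theorem coord_eq_zero_of_pforceB {q : ℕ} {U : Finset (Fin 4)} {G : Terms 5 k} {γ : Fin 4 → ℕ} {i : Fin 4}
    (hβ : β ≠ 0) (h : pforceB q U G γ i = true) {b : Fin 4 → K} (hb : ∀ m : Fin 4, m ∉ U → b m = 0)
    (hzero : coeff (expo γ) (PointBlowup.translate b (spec f β (evalT G))) = 0) : b i = 0 := by
  unfold pforceB at h
  simp only [Bool.and_eq_true] at h
  obtain ⟨-, hm⟩ := h
  rw [coeff_translate_spec_evalT, sum_pterm_filter f β γ hb] at hzero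
  unfold srcTerms at hm
  split at hm
  · rename_i t heq
    rw [heq] at hzero
    simp only [Bool.and_eq_true, decide_eq_true_eq, Bool.not_eq_true', decide_eq_false_iff_not] at hm
    obtain ⟨⟨⟨hoff, hlt⟩, hC⟩, hc⟩ := hm
    simp only [List.map_cons, List.map_nil, List.sum_cons, List.sum_nil, add_zero] at hzero
    unfold pterm at hzero
    rw [← Finset.mul_prod_erase univ _ (mem_univ i)] at hzero
    have hrest : (∏ m ∈ univ.erase i, (((t.1 m.castSucc).choose (γ m) : K) * b m ^ (t.1 m.castSucc - γ m))) = 1 :=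
      Finset.prod_eq_one fun m hm => by
        rw [hoff m (ne_of_mem_erase hm), Nat.choose_self, Nat.sub_self, pow_zero, Nat.cast_one, mul_one]
    rw [hrest, mul_one] at hzero
    have hCK : (((t.1 i.castSucc).choose (γ i) : ℕ) : K) ≠ 0 := fun h0 =>
      hC (f.injective (by rw [map_natCast, map_zero]; exact h0))
    rcases mul_eq_zero.mp hzero with h1 | h2
    · exact absurd h1 (mul_ne_zero ((map_ne_zero_iff f f.injective).mpr hc) (pow_ne_zero _ hβ))
    · exact (pow_eq_zero_iff (Nat.sub_ne_zero_of_lt hlt)).mp ((mul_eq_zero.mp h2).resolve_left hCK)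
  · exact absurd hm Bool.false_ne_true

/-- **root check** for the letter `i ∈ U` at a t-free chart: the sources of `γ` are TWO t-free terms, both differing
from `γ` exactly at `i`, by consecutive powers `d < d + 1`, with non-zero binomials; `ρ = −(c₁C₁)/(c₂C₂) ∈ k` is the
non-zero root (so the coefficient of `x^γ` is `bᵢ^d (A + B bᵢ)` and vanishes only at `bᵢ ∈ {0, f ρ}`).
OURS. [folklore] -/
def prootB (q : ℕ) (U : Finset (Fin 4)) (G : Terms 5 k) (γ : Fin 4 → ℕ) (i : Fin 4) (ρ : k) : Bool :=
  !decide (γ = 0) && decide (∑ i, γ i < q) && decide (i ∈ U) &&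
    match srcTerms U γ G with
    | [t₁, t₂] => decide (∀ m : Fin 4, m ≠ i → t₁.1 m.castSucc = γ m ∧ t₂.1 m.castSucc = γ m) &&
        decide (t₁.1 (Fin.last 4) = 0 ∧ t₂.1 (Fin.last 4) = 0) &&
        decide (t₂.1 i.castSucc = t₁.1 i.castSucc + 1 ∧ γ i ≤ t₁.1 i.castSucc) &&
        !decide (t₂.2 * (((t₂.1 i.castSucc).choose (γ i) : ℕ) : k) = 0) &&
        decide (ρ * (t₂.2 * (((t₂.1 i.castSucc).choose (γ i) : ℕ) : k)) =
          -(t₁.2 * (((t₁.1 i.castSucc).choose (γ i) : ℕ) : k)))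
    | _ => false

omit [DecidableEq K] in
/-- **a root check pins the letter**: if the coefficient of `x^γ` vanishes at `b` then `bᵢ = 0` or `bᵢ = f ρ`.
OURS. [folklore] -/
theorem coord_cases_of_prootB {q : ℕ} {U : Finset (Fin 4)} {G : Terms 5 k} {γ : Fin 4 → ℕ} {i : Fin 4} {ρ : k}
    (h : prootB q U G γ i ρ = true) {b : Fin 4 → K} (hb : ∀ m : Fin 4, m ∉ U → b m = 0)
    (hzero : coeff (expo γ) (PointBlowup.translate b (spec f β (evalT G))) = 0) : b i = 0 ∨ b i = f ρ := by
  unfold prootB at h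
  simp only [Bool.and_eq_true] at h
  obtain ⟨-, hm⟩ := h
  rw [coeff_translate_spec_evalT, sum_pterm_filter f β γ hb] at hzero
  unfold srcTerms at hm
  split at hm
  · rename_i t₁ t₂ heq
    rw [heq] at hzero
    simp only [Bool.and_eq_true, decide_eq_true_eq, Bool.not_eq_true', decide_eq_false_iff_not] at hm
    obtain ⟨⟨⟨⟨hoff, ht⟩, hdeg⟩, hB⟩, hρ⟩ := hm
    simp only [List.map_cons, List.map_nil, List.sum_cons, List.sum_nil, add_zero] at hzero
    unfold pterm at hzero
    rw [← Finset.mul_prod_erase univ _ (mem_univ i), ← Finset.mul_prod_erase univ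
      (fun m => (((t₂.1 m.castSucc).choose (γ m) : K) * b m ^ (t₂.1 m.castSucc - γ m))) (mem_univ i)] at hzero
    have hr1 : (∏ m ∈ univ.erase i, (((t₁.1 m.castSucc).choose (γ m) : K) * b m ^ (t₁.1 m.castSucc - γ m))) = 1 :=
      Finset.prod_eq_one fun m hm => by
        rw [(hoff m (ne_of_mem_erase hm)).1, Nat.choose_self, Nat.sub_self, pow_zero, Nat.cast_one, mul_one]
    have hr2 : (∏ m ∈ univ.erase i, (((t₂.1 m.castSucc).choose (γ m) : K) * b m ^ (t₂.1 m.castSucc - γ m))) = 1 :=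
      Finset.prod_eq_one fun m hm => by
        rw [(hoff m (ne_of_mem_erase hm)).2, Nat.choose_self, Nat.sub_self, pow_zero, Nat.cast_one, mul_one]
    rw [hr1, hr2, mul_one, mul_one, ht.1, ht.2, pow_zero, mul_one, mul_one, hdeg.1,
      show t₁.1 i.castSucc + 1 - γ i = (t₁.1 i.castSucc - γ i) + 1 from by omega, pow_succ] at hzero
    -- hzero : f c₁ * (C₁ * b^d) + f c₂ * (C₂ * (b^d * b)) = 0
    set d := t₁.1 i.castSucc - γ i with hd
    have hfac : b i ^ d * (f (t₁.2 * (((t₁.1 i.castSucc).choose (γ i) : ℕ) : k)) +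
        f (t₂.2 * (((t₁.1 i.castSucc + 1).choose (γ i) : ℕ) : k)) * b i) = 0 := by
      rw [map_mul, map_mul, map_natCast, map_natCast, ← hzero]; ring
    rcases mul_eq_zero.mp hfac with h1 | h2
    · by_cases hd0 : d = 0
      · rw [hd0, pow_zero] at h1; exact absurd h1 one_ne_zero
      · exact Or.inl ((pow_eq_zero_iff hd0).mp h1)
    · right
      rw [hdeg.1] at hB hρ
      have hBK : f (t₂.2 * (((t₁.1 i.castSucc + 1).choose (γ i) : ℕ) : k)) ≠ 0 :=
        (map_ne_zero_iff f f.injective).mpr hB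
      apply mul_right_cancel₀ hBK
      rw [← map_mul, hρ, map_neg]
      linear_combination h2
  · exact absurd hm Bool.false_ne_true

omit [Field K] [DecidableEq K] in
/-- the low-exponent data of a witness check. OURS. [folklore] -/
theorem pwitB_low {q : ℕ} {U : Finset (Fin 4)} {G : Terms 5 k} {γ : Fin 4 → ℕ} (h : pwitB q U G γ = true) :
    γ ≠ 0 ∧ ∑ i, γ i < q := by
  unfold pwitB at h
  simp only [Bool.and_eq_true, Bool.not_eq_true', decide_eq_false_iff_not, decide_eq_true_eq] at h
  exact ⟨h.1.1, h.1.2⟩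

omit [Field K] [DecidableEq K] in
/-- the low-exponent data of a forcing check. OURS. [folklore] -/
theorem pforceB_low {q : ℕ} {U : Finset (Fin 4)} {G : Terms 5 k} {γ : Fin 4 → ℕ} {i : Fin 4}
    (h : pforceB q U G γ i = true) : γ ≠ 0 ∧ ∑ i, γ i < q := by
  unfold pforceB at h
  simp only [Bool.and_eq_true, Bool.not_eq_true', decide_eq_false_iff_not, decide_eq_true_eq] at h
  exact ⟨h.1.1.1, h.1.1.2⟩

omit [Field K] [DecidableEq K] in
/-- the low-exponent data of a root check. OURS. [folklore] -/
theorem prootB_low {q : ℕ} {U : Finset (Fin 4)} {G : Terms 5 k} {γ : Fin 4 → ℕ} {i : Fin 4} {ρ : k}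
    (h : prootB q U G γ i ρ = true) : γ ≠ 0 ∧ ∑ i, γ i < q := by
  unfold prootB at h
  simp only [Bool.and_eq_true, Bool.not_eq_true', decide_eq_false_iff_not, decide_eq_true_eq] at h
  exact ⟨h.1.1.1, h.1.1.2⟩

end ParamLift

end Summit.ResolutionOfSingularities.ResolutionOfSingularities.Theorems.PIDim4

end
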